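import Literature.AlgebraicGeometry.Modules.CechUnitModulePairing
import Literature.AlgebraicGeometry.Modules.ModuleCechHZero
import Literature.Algebra.Homology.OrderedCechSystemCupClasses
import HarnessLib

/-!
# `Ȟ⁰(𝓥, 𝒪_X) = A · [1]` when `A → Γ(X, 𝒪_X)` is bijective (connectedness datum of the cohomology bialgebra)

For a scheme `X`, a cover `𝓥 = (V_i)` of `X` and a ring homomorphism `ρ : A → Γ(X, 𝒪_X)`, ★
`Modules/ModuleCechHZero` identifies the `0`-cocycles of the module Čech complex `Č•(𝓥, 𝒪_X)` with `Γ(X, 𝒪_X)`.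
When `ρ` is BIJECTIVE (e.g. `X` an abelian variety over a field `A = k`: `Γ(A, 𝒪_A) = k`, ★
`AbelianSchemeOver.app_bijective_of_isArtinianRing`), every class of `Ȟ⁰(𝓥, 𝒪_X)` is a scalar multiple of the
unit class: there is an `A`-linear `aug : Ȟ⁰ → A` with `z = aug z • [1]` for all `z` (`exists_augmentation`) — the
hypothesis `haug` (connectedness, `Ȟ⁰ = k · 1`) of the bialgebra assembly ★ `cup_one_one_surjective`, in its degree
convention `Ȟ⁰ = H^{((0 : ℕ) : ℤ)}` and with the unit cycle in the shape consumed by ★ `cupH_unit_left∕right`.  Also: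
cocycles of a system give cycles∕classes of `sysComplex` (`exists_cycles_eq`, `sysD_iCycles_apply`,
`homologyπ_injective_of_le_zero` — elementwise bookkeeping used by every instantiation of the ordered Čech classes), and
the unit `0`-cycle exists (`exists_unitCycle`). [cite: GortzWedhorn2023, Lemma 21.65 (p. 179)]
[cite: MumfordAV1970, §13 Cor. 2 (p. 129)]  Pure bookkeeping over ★ files; no definition.
-/

noncomputable section

universe u

open CategoryTheory CategoryTheory.Limits AlgebraicGeometry TopologicalSpace Opposite HomologicalComplex
open Literature.Algebra.Homology Literature.Algebra.Homology.OrderedCech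

namespace Literature.AlgebraicGeometry.Modules

set_option backward.isDefEq.respectTransparency false

/-! ### Cocycles of a system as cycles and classes of `sysComplex` -/

section System

variable {ι : Type} [LinearOrder ι] {A : Type u} [CommRing A] (M : Finset ι ⥤ ModuleCat.{u} A)

/-- **A cocycle is a cycle**: every `n`-cochain `g` of a system with `d g = 0` underlies a (unique) cycle of the ordered
Čech complex `sysComplex M`. [cite: GortzWedhorn2023, Def. 21.68 (p. 180)] -/
theorem exists_cycles_eq (n : ℤ) (g : SysCochain M n) (hg : sysD M n g = 0) :
    ∃ z : (sysComplex M).cycles n, ((sysComplex M).iCycles n).hom z = g := by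
  let k : ModuleCat.of A A ⟶ (sysComplex M).X n := ModuleCat.ofHom (LinearMap.toSpanSingleton A (SysCochain M n) g)
  have hk : k ≫ (sysComplex M).d n (n + 1) = 0 := by
    rw [sysComplex_d]
    refine ModuleCat.hom_ext (LinearMap.ext_ring ?_)
    change sysD M n ((1 : A) • g) = 0
    rw [one_smul, hg]
  refine ⟨((sysComplex M).liftCycles k (n + 1) (by simp) hk).hom 1, ?_⟩
  change ((sysComplex M).liftCycles k (n + 1) (by simp) hk ≫ (sysComplex M).iCycles n).hom 1 = g
  rw [liftCycles_i]
  change (1 : A) • g = g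
  exact one_smul A g

/-- The underlying cochain of a cycle is a cocycle: `d (ι z) = 0`. [cite: GortzWedhorn2023, Def. 21.68 (p. 180)] -/
theorem sysD_iCycles_apply (n : ℤ) (z : (sysComplex M).cycles n) : sysD M n (((sysComplex M).iCycles n).hom z) = 0 := by
  have h := (sysComplex M).iCycles_d n (n + 1)
  rw [sysComplex_d] at h
  exact congrArg (fun f => f.hom z) h

/-- In degrees `n ≤ 0` there are no coboundaries: `π : Zⁿ → Hⁿ` is an isomorphism. [cite: GortzWedhorn2023, Lemma 21.65 (p. 179)] -/
theorem isIso_homologyπ_of_le_zero (n : ℤ) (hn : n ≤ 0) : IsIso ((sysComplex M).homologyπ n) :=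
  (sysComplex M).isIso_homologyπ (n - 1) n (by simp)
    ((isZero_sysComplex_X_of_neg M (n - 1) (by omega)).eq_of_src _ _)

/-- In degrees `n ≤ 0`, cycles with the same class are equal (`π` is injective). [cite: GortzWedhorn2023, Lemma 21.65 (p. 179)] -/
theorem homologyπ_injective_of_le_zero (n : ℤ) (hn : n ≤ 0) : Function.Injective ((sysComplex M).homologyπ n).hom := by
  haveI := isIso_homologyπ_of_le_zero M n hn
  exact (ModuleCat.mono_iff_injective _).1 inferInstance

end System

/-! ### The unit module: `0`-cocycles are scalars -/

variable {X : Scheme.{u}} {ι : Type} (𝓥 : ι → X.Opens) {A : Type u} [CommRing A] (ρ : A →+* Γ(X, ⊤))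

/-- At the top open the structure map is `ρ` itself: `toSections ρ ⊤ a = ρ a`. [cite: GortzWedhorn2023, Def. 21.68 (p. 180)] -/
theorem toSections_top (a : A) : toSections ρ ⊤ a = ρ a := by
  change (X.presheaf.map (homOfLE le_top).op) (ρ a) = ρ a
  have : (homOfLE (le_top : (⊤ : X.Opens) ≤ ⊤)) = 𝟙 _ := Subsingleton.elim _ _
  rw [this, op_id, X.presheaf.map_id]
  rfl

/-- `a • 1 = ρ(a)` in `Γ(𝒪_X, X)` (as an `A`-module through `ρ`). [cite: GortzWedhorn2023, Def. 21.68 (p. 180)] -/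
theorem smul_ofRing_one_top (a : A) :
    a • (SecMod.ofRing ρ (1 : Γ(X, ⊤)) : SecMod (unitModule X) ρ ⊤) = SecMod.ofRing ρ (ρ a) := by
  apply SecMod.toRing_injective ρ
  rw [SecMod.toRing_smul, SecMod.toRing_ofRing, SecMod.toRing_ofRing, mul_one, toSections_top]

/-- `a ↦ a • 1 : A → Γ(𝒪_X, X)` is bijective when `ρ` is. [cite: GortzWedhorn2023, Def. 21.68 (p. 180)] -/
theorem toSpanSingleton_ofRing_one_bijective (hρ : Function.Bijective ρ) :
    Function.Bijective
      (LinearMap.toSpanSingleton A (SecMod (unitModule X) ρ ⊤) (SecMod.ofRing ρ (1 : Γ(X, ⊤)))) := by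
  constructor
  · intro a b hab
    have h : SecMod.ofRing ρ (ρ a) = SecMod.ofRing ρ (ρ b) := by
      rw [← smul_ofRing_one_top, ← smul_ofRing_one_top]
      exact hab
    exact hρ.1 (congrArg (SecMod.toRing ρ) h)
  · intro t
    obtain ⟨a, ha⟩ := hρ.2 (SecMod.toRing ρ t)
    exact ⟨a, by rw [LinearMap.toSpanSingleton_apply, smul_ofRing_one_top, ha, SecMod.ofRing_toRing]⟩

variable [LinearOrder ι]

/-- The augmentation of the unit section is the unit `0`-cochain: `(1|_{V_i})_i = (1)_i`.
[cite: GortzWedhorn2023, Lemma 21.65 (p. 179)] -/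
theorem cechAugment_ofRing_one_apply (σ : Simplex ι 0) :
    cechAugment 𝓥 (unitModule X) ρ (SecMod.ofRing ρ 1) σ = unitFamily 𝓥 ρ σ.1 := by
  apply SecMod.toRing_injective ρ
  rw [cechAugment_apply, SecMod.toRing_res, SecMod.toRing_ofRing, map_one, toRing_unitFamily]

/-- **Every `0`-cocycle of `Č•(𝓥, 𝒪_X)` is a scalar multiple of the unit cochain** when `ρ : A → Γ(X, 𝒪_X)` is onto and
the `V_i` cover `X`: `g = a • (1)_i` for some `a ∈ A`. [cite: GortzWedhorn2023, Lemma 21.65 (p. 179)] -/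
theorem exists_forall_eq_smul_unitFamily (hcov : ⨆ i, 𝓥 i = ⊤) (hρ : Function.Surjective ρ)
    (g : SysCochain (sectionsSystem 𝓥 (unitModule X) ρ) 0) (hg : sysD (sectionsSystem 𝓥 (unitModule X) ρ) 0 g = 0) :
    ∃ a : A, ∀ σ : Simplex ι 0, g σ = a • unitFamily 𝓥 ρ σ.1 := by
  obtain ⟨t, ht⟩ := exists_cechAugment_eq 𝓥 (unitModule X) ρ hcov g hg
  obtain ⟨a, ha⟩ := hρ (SecMod.toRing ρ t)
  refine ⟨a, fun σ => ?_⟩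
  have htt : t = a • SecMod.ofRing ρ (1 : Γ(X, ⊤)) := by
    rw [smul_ofRing_one_top, ha, SecMod.ofRing_toRing]
  rw [← ht, htt, map_smul, ← cechAugment_ofRing_one_apply]
  rfl

/-- **The unit `0`-cycle exists**: a cycle `e` of `Č•(𝓥, 𝒪_X)` in degree `0 = ((0 : ℕ) : ℤ)` whose underlying cochain is
`σ ↦ 1 ∈ Γ(𝒪, V_σ)` (the shape of the unit hypothesis `he` of ★ `cupH_unit_left∕right` for `u := unitFamily 𝓥 ρ`).
[cite: GortzWedhorn2023, Lemma 21.65 (p. 179)] -/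
theorem exists_unitCycle :
    ∃ e : (cechComplex 𝓥 (unitModule X) ρ).cycles ((0 : ℕ) : ℤ),
      ((cechComplex 𝓥 (unitModule X) ρ).iCycles _).hom e =
        (fun σ => unitFamily 𝓥 ρ σ.1 : SysCochain (sectionsSystem 𝓥 (unitModule X) ρ) ((0 : ℕ) : ℤ)) :=
  exists_cycles_eq (sectionsSystem 𝓥 (unitModule X) ρ) ((0 : ℕ) : ℤ) _ (sysD_unitCochain_eq_zero 𝓥 ρ)

/-- **`Ȟ⁰(𝓥, 𝒪_X)` is spanned by the unit class over `A`, linearly** (connectedness datum `haug` of ★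
`cup_one_one_surjective`): if `ρ : A → Γ(X, 𝒪_X)` is bijective and the `V_i` cover `X`, there is an `A`-linear
`aug : Ȟ⁰ → A` with `z = aug z • [e]` for every class `z ∈ Ȟ⁰ = H^{((0 : ℕ) : ℤ)}`, `e` the unit `0`-cycle.
[cite: GortzWedhorn2023, Lemma 21.65 (p. 179)] [cite: MumfordAV1970, §13 Cor. 2 (p. 129)] -/
theorem exists_augmentation (hcov : ⨆ i, 𝓥 i = ⊤) (hρ : Function.Bijective ρ)
    (e : (cechComplex 𝓥 (unitModule X) ρ).cycles ((0 : ℕ) : ℤ))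
    (he : ((cechComplex 𝓥 (unitModule X) ρ).iCycles _).hom e =
      (fun σ => unitFamily 𝓥 ρ σ.1 : SysCochain (sectionsSystem 𝓥 (unitModule X) ρ) ((0 : ℕ) : ℤ))) :
    ∃ aug : (cechComplex 𝓥 (unitModule X) ρ).homology ((0 : ℕ) : ℤ) →ₗ[A] A,
      ∀ z : (cechComplex 𝓥 (unitModule X) ρ).homology ((0 : ℕ) : ℤ),
        z = aug z • ((cechComplex 𝓥 (unitModule X) ρ).homologyπ _).hom e := by
  -- every `0`-cycle is a scalar multiple of `e`
  have hcyc : ∀ c : (cechComplex 𝓥 (unitModule X) ρ).cycles ((0 : ℕ) : ℤ), ∃ a : A, c = a • e := by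
    intro c
    obtain ⟨a, ha⟩ := exists_forall_eq_smul_unitFamily 𝓥 ρ hcov hρ.2 _
      (sysD_iCycles_apply (sectionsSystem 𝓥 (unitModule X) ρ) ((0 : ℕ) : ℤ) c)
    refine ⟨a, cycles_ext _ _ ?_⟩
    rw [map_smul, he]
    funext σ
    exact ha σ
  -- `π : Z⁰ → H⁰` is an isomorphism (no coboundaries in degree `0`)
  haveI := isIso_homologyπ_of_le_zero (sectionsSystem 𝓥 (unitModule X) ρ) ((0 : ℕ) : ℤ) (by simp)
  let f₁ : (cechComplex 𝓥 (unitModule X) ρ).homology ((0 : ℕ) : ℤ) →ₗ[A]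
      (cechComplex 𝓥 (unitModule X) ρ).cycles ((0 : ℕ) : ℤ) :=
    (inv ((cechComplex 𝓥 (unitModule X) ρ).homologyπ ((0 : ℕ) : ℤ))).hom
  have hf₁ : ∀ c, f₁ (((cechComplex 𝓥 (unitModule X) ρ).homologyπ ((0 : ℕ) : ℤ)).hom c) = c := fun c => by
    change (((cechComplex 𝓥 (unitModule X) ρ).homologyπ ((0 : ℕ) : ℤ)) ≫
      inv ((cechComplex 𝓥 (unitModule X) ρ).homologyπ ((0 : ℕ) : ℤ))).hom c = c
    rw [IsIso.hom_inv_id]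
    rfl
  -- the functional `aug`: `H⁰ ≅ Z⁰ → ker d⁰ ≅ Γ(X, 𝒪_X) ≅ A`, `[a • e] ↦ a`
  let f₂ : (cechComplex 𝓥 (unitModule X) ρ).cycles ((0 : ℕ) : ℤ) →ₗ[A]
      LinearMap.ker (sysD (sectionsSystem 𝓥 (unitModule X) ρ) 0) :=
    LinearMap.codRestrict _ ((cechComplex 𝓥 (unitModule X) ρ).iCycles _).hom fun c =>
      sysD_iCycles_apply (sectionsSystem 𝓥 (unitModule X) ρ) ((0 : ℕ) : ℤ) c
  let f₃ : LinearMap.ker (sysD (sectionsSystem 𝓥 (unitModule X) ρ) 0) →ₗ[A] SecMod (unitModule X) ρ ⊤ :=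
    (kerDZeroEquiv 𝓥 (unitModule X) ρ hcov).symm.toLinearMap
  let f₄ : SecMod (unitModule X) ρ ⊤ →ₗ[A] A :=
    (LinearEquiv.ofBijective _ (toSpanSingleton_ofRing_one_bijective ρ hρ)).symm.toLinearMap
  have h2 : f₂ e = kerDZeroEquiv 𝓥 (unitModule X) ρ hcov (SecMod.ofRing ρ 1) := by
    apply Subtype.ext
    rw [coe_kerDZeroEquiv_apply, LinearMap.codRestrict_apply]
    exact he.trans (funext fun σ => (cechAugment_ofRing_one_apply 𝓥 ρ σ).symm)
  have h3 : f₃ (f₂ e) = SecMod.ofRing ρ 1 := by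
    rw [h2]
    exact (kerDZeroEquiv 𝓥 (unitModule X) ρ hcov).symm_apply_apply _
  have h4 : f₄ (SecMod.ofRing ρ 1) = 1 := by
    change (LinearEquiv.ofBijective _ (toSpanSingleton_ofRing_one_bijective ρ hρ)).symm _ = 1
    rw [LinearEquiv.symm_apply_eq, LinearEquiv.ofBijective_apply, LinearMap.toSpanSingleton_apply, one_smul]
  have haug_e : f₄ (f₃ (f₂ e)) = 1 := by rw [h3, h4]
  refine ⟨(f₄ ∘ₗ f₃ ∘ₗ f₂) ∘ₗ f₁, fun z => ?_⟩
  obtain ⟨c, rfl⟩ := homologyπ_surjective (cechComplex 𝓥 (unitModule X) ρ) _ z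
  obtain ⟨a, rfl⟩ := hcyc c
  simp only [LinearMap.comp_apply, map_smul, hf₁, haug_e, smul_eq_mul, mul_one]

end Literature.AlgebraicGeometry.Modules

end
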